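import Summits.QuantumFields.BalabanUV.Beta.GAN24.BornBorderUndressedRow
import Summits.QuantumFields.BalabanUV.Beta.GAN24.S3DiffVSymAt
import Summits.QuantumFields.BalabanUV.Beta.GAN24.TopBorderKSlotSymAt

/-!
# GAN24 ∕ BORNSEC, V half — `BornBorderUndressedDrift`: THE UNDRESSED TOP-ALIGNED V PAIR LETTER (births `≥ 1`, sup currency) FROM ROAD S3's ROOTED SYMMETRIC-TABLE DIFF ROWS
# (`d = 3`, `2 ≤ Lc`, pin `cE = Lc^4`, every `cVH`, every in-block root) — «ROOTED-S3-V-DIFF» part (e), the V twin of leaf-06 g41's `BornLambdaUndressedDrift`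

NOT IN PRINT; OUR BOOKKEEPING (G-an2-4 formalisation swarm → CRUX TEAM (2), leaf prover `b2b-balaban-gan24-formalise-leaf-04`, gen 57; journal `CLAIMS.log` INTENT
«ROOTED-S3-V-DIFF»).  [folklore] finite bookkeeping BY NAME over the owner gan24-p1 g21's exponent identities `BornBorderUndressedRow.lineage_v_succ_pin_apply` (births `j+1`,
lengths `n+2`) ∕ `lineage_v_top_pin_apply` (births `j+1`, length `1`) — each weighted undressed V lineage IS `Lc^4 ×` road S3's rooted symmetric-table row object — and the
rooted DIFF rows typed by this lineage this generation: `S3DiffVSymAt.diffV_three_at` (parts (a)(b)(c)) and `TopBorderKSlotSymAt.diffVt_three_at` (part (d)).  0 `def`, 0 cited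
facts, 0 `def … : Prop`, 0 sorry; NO estimate of Bałaban's.  HONEST FRAMING (cell contract, verbatim): «discharging `BetaPertH` makes Bałaban's UV stability UNCONDITIONAL —
a real constructive-QFT result; it is NOT the continuum limit and NOT the Clay problem.»  HONEST DEPENDENCY (verbatim): «continuum YM on T⁴ ⇐ BetaPertH ∧ nine spine estimates
(0/9 proved); BetaPertH ⇐ (D1) ∧ (D4) ∧ CAP+tail; G-an2-4 gates asym, D1 and NE2/3/4.»  HONEST: this is the UNDRESSED half of the V pair letter of the born-V rate socket
`BornBorderDriftThree.exists_hBdevV_three_of_supPairs`; the CONTACT half (leaf-03's (V-C) cells with one slot differenced) is OPEN; discharges NOTHING of hBdev ∕ (hS, hSall)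
by itself; NEVER «G-an2-4 closed» as (CONV-C); NOT D1, NOT BetaPertH, NOT continuum, NOT Clay.

WHAT.  **`exists_pairU_v_sup_three (hLc : 2 ≤ Lc) (hcE : cE = (Lc:ℝ)^(3+1)) (cVH) : ∃ CU Θ, 0 ≤ CU ∧ 0 < Θ ∧ Θ < 1 ∧ ∀ rr ∈ box (3+1) Lc, ∀ k i, 1 ≤ i → i < k → ∀ κ u,
SupBound ((U(i+1,k+1) − U(i,k)) κ u) (CU·Θ^k)`**, `U(i,k) = (cE·Lc^8)^{k−i} • push₃ (respStep (Lc^(i+1)) (Lc^k))³ X⁰_i` the owner's undressed V lineage (the object of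
`exists_hUgV_of_rootedRows`), the upper member written with the same weight exponent `k − i` and legs `respStep (Lc^(i+2)) (Lc^(k+1))`: for EVERY in-block root, every
birth `i ≥ 1` and every `k > i` the top-aligned undressed pair is `≤ CU·Θ^k` entrywise — lengths `≥ 2` by the rooted row dV at `(n, m) = (k−2, i−1)` (rate `θ^{k−1}·ρ^{k−i−1}`,
the `ρ` dropped), length `1` by the rooted row dVt at `n = i−1` (rate `θ^{k−1}`); ONE `CU = Lc^4·(cV + max cVt 0)∕Θ`, ONE `Θ = max (max θ_V θ_Vt) ½`.
Unit `b2b-balaban-gan24-formalise-leaf-04` (gen 57), 2026-08-21.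
-/

noncomputable section

open Finset
open scoped BigOperators
open Literature.MathematicalPhysics.QuantumFieldTheory
open Literature.MathematicalPhysics.QuantumFieldTheory.Balaban1983to89
open Literature.MathematicalPhysics.QuantumFieldTheory.Balaban1983to89.Beta
open ExpKernelCalculus (MKer)
open OneStepResolventKernel (Fib LocStencil KInv)
open AffineAveraging (box toSite)
open AveragingHessianKernelsRooted (vhSAt)
open BalabanCompositeJets (respStep pushSum)
open DecLiftAdjoint (borderSum)
open Summit.QuantumFields.BalabanUV.Beta.GAN24.CombesThomas (SupBound KStepUnit)
open Summit.QuantumFields.BalabanUV.Beta.GAN24.E3UnitSplit (e3OfS)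
open Summit.QuantumFields.BalabanUV.Beta.GAN24.Push3 (push₃)
open Summit.QuantumFields.BalabanUV.Beta.GAN24.SrecLinearPartEq (colM rowMM reslot)
open Summit.QuantumFields.BalabanUV.Beta.GAN24.BornBorderUndressedRow (lineage_v_succ_pin_apply lineage_v_top_pin_apply)
open Summit.QuantumFields.BalabanUV.Beta.GAN24.S3DiffVSymAt (diffV_three_at)
open Summit.QuantumFields.BalabanUV.Beta.GAN24.TopBorderKSlotSymAt (diffVt_three_at)

namespace Summit.QuantumFields.BalabanUV.Beta.GAN24.BornBorderUndressedDrift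

variable {Lc : ℕ} [NeZero Lc]

/-- NOT IN PRINT; OUR BOOKKEEPING (`d = 3`, `2 ≤ Lc`, pin `cE = Lc^4`, UNCONDITIONAL; [folklore] assembly BY NAME).  **THE UNDRESSED TOP-ALIGNED V PAIR LETTER, BIRTHS
`≥ 1`, SUP CURRENCY**: for EVERY in-block root, every birth `i ≥ 1` and every `k > i`, the weighted UNDRESSED V lineage of member `k+1` born at `i+1` minus that of
member `k` born at `i` is `≤ CU·Θ^k` entrywise (ONE `CU ≥ 0`, ONE `0 < Θ < 1`) — by the owner's exponent identities the pair IS `Lc^4 ×` road S3's rooted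
symmetric-table DIFF rows: `S3DiffVSymAt.diffV_three_at` at `(n, m) = (k−2, i−1)` for lengths `k − i ≥ 2` (its `ρ^{n−m}` dropped), `TopBorderKSlotSymAt.diffVt_three_at`
at `n = i−1` for length `1`.  The CONTACT V pairs are NOT here; discharges NOTHING of hBdev by itself; NEVER «G-an2-4 closed». -/
theorem exists_pairU_v_sup_three (hLc : 2 ≤ Lc) {cE : ℝ} (hcE : cE = (Lc : ℝ) ^ (3 + 1)) (cVH : ℝ) :
    ∃ CU Θ : ℝ, 0 ≤ CU ∧ 0 < Θ ∧ Θ < 1 ∧ ∀ (rr : Fin (3 + 1) → ℕ), rr ∈ box (3 + 1) Lc → ∀ k i : ℕ, 1 ≤ i → i < k → ∀ κ u,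
      SupBound
        (((fun κ' u' => (cE * (Lc : ℝ) ^ (2 * (3 + 1))) ^ (k - i) •
            push₃ (respStep (d := 3) (Lc ^ (i + 1 + 1)) (Lc ^ (k + 1))) (respStep (d := 3) (Lc ^ (i + 1 + 1)) (Lc ^ (k + 1)))
              (respStep (d := 3) (Lc ^ (i + 1 + 1)) (Lc ^ (k + 1)))
              (fun κ u => -(push₃ (-respStep (d := 3) (Lc ^ (i + 1)) (Lc ^ (i + 1 + 1))) (colM (KStepUnit (d := 3) Lc (i + 1)) Lc)
                    (respStep (d := 3) (Lc ^ (i + 1)) (Lc ^ (i + 1 + 1))) (reslot Sum.inl Sum.inr fun κ u => cVH • vhSAt (toSite rr) 3 Lc rfl κ u) κ u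
                + push₃ (rowMM (KStepUnit (d := 3) Lc (i + 1)) Lc) (respStep (d := 3) (Lc ^ (i + 1)) (Lc ^ (i + 1 + 1)))
                    (respStep (d := 3) (Lc ^ (i + 1)) (Lc ^ (i + 1 + 1))) (reslot Sum.inr Sum.inl fun κ u => cVH • vhSAt (toSite rr) 3 Lc rfl κ u) κ u))
              κ' u')
          - fun κ' u' => (cE * (Lc : ℝ) ^ (2 * (3 + 1))) ^ (k - i) •
            push₃ (respStep (d := 3) (Lc ^ (i + 1)) (Lc ^ k)) (respStep (d := 3) (Lc ^ (i + 1)) (Lc ^ k)) (respStep (d := 3) (Lc ^ (i + 1)) (Lc ^ k))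
              (fun κ u => -(push₃ (-respStep (d := 3) (Lc ^ i) (Lc ^ (i + 1))) (colM (KStepUnit (d := 3) Lc i) Lc)
                    (respStep (d := 3) (Lc ^ i) (Lc ^ (i + 1))) (reslot Sum.inl Sum.inr fun κ u => cVH • vhSAt (toSite rr) 3 Lc rfl κ u) κ u
                + push₃ (rowMM (KStepUnit (d := 3) Lc i) Lc) (respStep (d := 3) (Lc ^ i) (Lc ^ (i + 1)))
                    (respStep (d := 3) (Lc ^ i) (Lc ^ (i + 1))) (reslot Sum.inr Sum.inl fun κ u => cVH • vhSAt (toSite rr) 3 Lc rfl κ u) κ u))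
              κ' u') κ u)
        (CU * Θ ^ k) := by
  have hLc1 : 1 ≤ Lc := le_trans (by norm_num) hLc
  have hL0 : (0 : ℝ) ≤ (Lc : ℝ) := Nat.cast_nonneg Lc
  obtain ⟨cV, θ₁, ρ, hcV, hθ₁0, hθ₁1, hρ0, hρ1, hdV⟩ := diffV_three_at (Lc := Lc) hLc cVH
  obtain ⟨cVt, θ₂, hθ₂0, hθ₂1, hdVt⟩ := diffVt_three_at (Lc := Lc) hLc cVH
  set Θ : ℝ := max (max θ₁ θ₂) (1 / 2) with hΘ
  have hΘ0 : 0 < Θ := lt_of_lt_of_le (by norm_num) (le_max_right _ _)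
  have hΘ1 : Θ < 1 := max_lt (max_lt hθ₁1 hθ₂1) (by norm_num)
  have hθ₁Θ : θ₁ ≤ Θ := (le_max_left _ _).trans (le_max_left _ _)
  have hθ₂Θ : θ₂ ≤ Θ := (le_max_right _ _).trans (le_max_left _ _)
  set A : ℝ := (Lc : ℝ) ^ (3 + 1) * (cV + max cVt 0) with hA
  have hA0 : 0 ≤ A := by positivity
  have hkey : ∀ m : ℕ, A / Θ * Θ ^ (m + 1) = A * Θ ^ m := by
    intro m
    rw [pow_succ]
    field_simp
  refine ⟨A / Θ, Θ, div_nonneg hA0 hΘ0.le, hΘ0, hΘ1, fun rr hrr k i hi hik κ u x z a b => ?_⟩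
  rw [Pi.sub_apply, Pi.sub_apply, Pi.sub_apply, Pi.sub_apply, Pi.sub_apply, Pi.sub_apply]
  obtain ⟨j, rfl⟩ : ∃ j, i = j + 1 := ⟨i - 1, by omega⟩
  rcases Nat.lt_or_ge (j + 1 + 1) k with hlt | hge
  · -- lengths ≥ 2: `k = j + 1 + (n + 1) + 1`, both members by `lineage_v_succ_pin_apply`, the pair = `Lc^4 ×` the rooted row dV at `(j+n+1, j)`
    obtain ⟨n, rfl⟩ : ∃ n, k = j + 1 + (n + 1) + 1 := ⟨k - j - 3, by omega⟩
    rw [show j + 1 + (n + 1) + 1 - (j + 1) = n + 1 + 1 by omega, show j + 1 + (n + 1) + 1 + 1 = j + 1 + 1 + (n + 1) + 1 by omega,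
      lineage_v_succ_pin_apply hLc1 hrr hcE cVH (j + 1) n κ u x z a b, lineage_v_succ_pin_apply hLc1 hrr hcE cVH j n κ u x z a b, ← mul_sub,
      abs_mul, abs_of_nonneg (by positivity : (0 : ℝ) ≤ (Lc : ℝ) ^ (3 + 1))]
    have hd := hdV rr hrr (j + n + 1) j (by omega) κ u x z a b
    rw [show j + n + 1 - j = n + 1 by omega, show j + n + 1 + 1 + 1 + 1 = j + 1 + (n + 1) + 1 + 1 by omega,
      show j + n + 1 + 1 + 1 = j + (n + 1) + 1 + 1 by omega] at hd
    rw [show j + 1 + (n + 1) - (j + 1) = n + 1 by omega, show j + (n + 1) - j = n + 1 by omega]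
    refine (mul_le_mul_of_nonneg_left hd (by positivity)).trans ?_
    -- `Lc^4 · cV θ₁^(j+n+2) ρ^(n+1) ≤ (A/Θ)·Θ^(j+1+(n+1)+1)`
    rw [show j + 1 + (n + 1) + 1 = (j + n + 1 + 1) + 1 by omega, hkey]
    have hρn : ρ ^ (n + 1) ≤ 1 := pow_le_one₀ hρ0 hρ1.le
    have hθn : θ₁ ^ (j + n + 1 + 1) ≤ Θ ^ (j + n + 1 + 1) := pow_le_pow_left₀ hθ₁0 hθ₁Θ _
    have hΘn : 0 ≤ Θ ^ (j + n + 1 + 1) := pow_nonneg hΘ0.le _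
    calc (Lc : ℝ) ^ (3 + 1) * (cV * θ₁ ^ (j + n + 1 + 1) * ρ ^ (n + 1))
        ≤ (Lc : ℝ) ^ (3 + 1) * (cV * Θ ^ (j + n + 1 + 1) * 1) := by
          refine mul_le_mul_of_nonneg_left ?_ (by positivity)
          exact mul_le_mul (mul_le_mul_of_nonneg_left hθn hcV) hρn (pow_nonneg hρ0 _) (mul_nonneg hcV hΘn)
      _ ≤ A * Θ ^ (j + n + 1 + 1) := by
          rw [hA, mul_one, ← mul_assoc]
          refine mul_le_mul_of_nonneg_right (mul_le_mul_of_nonneg_left ?_ (by positivity)) hΘn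
          linarith [le_max_right cVt 0]
  · -- length 1: `k = j + 1 + 1`, both members by `lineage_v_top_pin_apply`, the pair = `Lc^4 ×` the rooted row dVt at `j`
    obtain rfl : k = j + 1 + 1 := by omega
    rw [show j + 1 + 1 - (j + 1) = 1 by omega,
      lineage_v_top_pin_apply hLc1 hrr hcE cVH (j + 1) κ u x z a b, lineage_v_top_pin_apply hLc1 hrr hcE cVH j κ u x z a b, ← mul_sub,
      abs_mul, abs_of_nonneg (by positivity : (0 : ℝ) ≤ (Lc : ℝ) ^ (3 + 1))]
    have hd := hdVt rr hrr j κ u x z a b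
    refine (mul_le_mul_of_nonneg_left hd (by positivity)).trans ?_
    -- `Lc^4 · cVt θ₂^(j+1) ≤ (A/Θ)·Θ^(j+1+1)`
    rw [hkey]
    have hθn : θ₂ ^ (j + 1) ≤ Θ ^ (j + 1) := pow_le_pow_left₀ hθ₂0 hθ₂Θ _
    have hΘn : 0 ≤ Θ ^ (j + 1) := pow_nonneg hΘ0.le _
    calc (Lc : ℝ) ^ (3 + 1) * (cVt * θ₂ ^ (j + 1)) ≤ (Lc : ℝ) ^ (3 + 1) * (max cVt 0 * Θ ^ (j + 1)) := by
          refine mul_le_mul_of_nonneg_left ?_ (by positivity)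
          calc cVt * θ₂ ^ (j + 1) ≤ max cVt 0 * θ₂ ^ (j + 1) := mul_le_mul_of_nonneg_right (le_max_left _ _) (pow_nonneg hθ₂0 _)
            _ ≤ max cVt 0 * Θ ^ (j + 1) := mul_le_mul_of_nonneg_left hθn (le_max_right _ _)
      _ ≤ A * Θ ^ (j + 1) := by
          rw [hA, ← mul_assoc]
          refine mul_le_mul_of_nonneg_right (mul_le_mul_of_nonneg_left ?_ (by positivity)) hΘn
          linarith

end Summit.QuantumFields.BalabanUV.Beta.GAN24.BornBorderUndressedDrift

end
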